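import Mathlib

/-!
# The ledger bootstrap (stub S4 of line `docking-census-joining`)

Crux `stmt-CriticalPhenomena-7117`
(`Summit.CriticalPhenomena.SAWScalingLimit.Theses.SAWTotalPositivity.CriticalBubbleBound`),
line `docking-census-joining`, registered stub `stub_ledgerBootstrap` ("the ledger bootstrap").

Pure real analysis, Mathlib only.  For a nonnegative sequence `t` write
`R i := ∑ n ∈ [2^i, 2^(i+1)), t n` for the dyadic block masses.  From
* the a-priori stretched-exponential bound `t n ≤ exp (K √n)`,
* an injection `D i ≤ K₁ U i`,
* docking entropy `c 2^((κ-1) i) (R i)^2 ≤ D i` for `i ≥ i₀`,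
* pinch rarity `U i ≤ C (i+1)^b 2^(-π i) R (i+1) + C 2^(-4 i)`,
we prove `R i ≤ C' 2^(s i)` for every `s > 1 - (κ + π)` with `s ≥ -3/2`.

Proof.  Put `Q i := R i * 2^(-s i)`.  The three structural inputs combine (using `κ ≥ 0`,
`3 + 2 s ≥ 0` and the domination of `(i+1)^b` by `2^(δ i)`, `δ := s - (1 - κ - π) > 0`) into the
one-step recursion `Q i ^ 2 ≤ B Q (i+1) + A` for `i ≥ i₀`; the a-priori bound gives
`Q i ≤ exp (E 2^(i/2))`.  A bootstrap shows `Q j ≤ L exp (E 2^((j-r)/2))` for all `r, j`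
(induction on `r`: squaring halves the exponent `(j+1-r)/2 ↦ (j-(r+1))/2`, the constant `L` is a
fixed point of `L ↦ √(B L + A)` dominating the finitely many `j < i₀`), and `r := j` bounds `Q`.
-/

noncomputable section

open scoped BigOperators

namespace Summit.CriticalPhenomena.SAWScalingLimit.Theorems.CriticalBubbleBound.Docking

/-- Polynomial growth is dominated by geometric growth: for `δ > 0` there is `M ≥ 0` with
`(i+1)^β ≤ M 2^(δ i)` for every natural number `i`. -/
private lemma ledgerBootstrap_poly_le_geom (β δ : ℝ) (hδ : 0 < δ) :
    ∃ M : ℝ, 0 ≤ M ∧ ∀ i : ℕ, ((i : ℝ) + 1) ^ β ≤ M * (2 : ℝ) ^ (δ * (i : ℝ)) := by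
  have hlog : 0 < Real.log 2 := Real.log_pos (by norm_num)
  have hβ1 : 1 ≤ max β 1 := le_max_right _ _
  have hβ0 : 0 < max β 1 := by linarith
  have hβne : max β 1 ≠ 0 := hβ0.ne'
  have hu0 : 0 < δ * Real.log 2 / max β 1 := div_pos (mul_pos hδ hlog) hβ0
  set u := δ * Real.log 2 / max β 1 with hu
  set m := min 1 u with hm
  have hm0 : 0 < m := lt_min one_pos hu0
  have hm1 : m ≤ 1 := min_le_left _ _
  have hmu : m ≤ u := min_le_right _ _
  have hmβ : 0 < m ^ (max β 1) := Real.rpow_pos_of_pos hm0 _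
  refine ⟨(m ^ (max β 1))⁻¹, (inv_pos.mpr hmβ).le, fun i => ?_⟩
  have hi : (0 : ℝ) ≤ i := Nat.cast_nonneg i
  have hi1 : (1 : ℝ) ≤ (i : ℝ) + 1 := by linarith
  have h1 : ((i : ℝ) + 1) ^ β ≤ ((i : ℝ) + 1) ^ (max β 1) :=
    Real.rpow_le_rpow_of_exponent_le hi1 (le_max_left _ _)
  have h2 : m * ((i : ℝ) + 1) ≤ Real.exp (u * i) := by
    have hmi : m * (i : ℝ) ≤ u * i := mul_le_mul_of_nonneg_right hmu hi
    linarith [Real.add_one_le_exp (u * i)]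
  have h3 : (m * ((i : ℝ) + 1)) ^ (max β 1) ≤ Real.exp (u * i) ^ (max β 1) :=
    Real.rpow_le_rpow (mul_nonneg hm0.le (by linarith)) h2 hβ0.le
  have h4 : Real.exp (u * i) ^ (max β 1) = (2 : ℝ) ^ (δ * (i : ℝ)) := by
    rw [← Real.exp_mul, Real.rpow_def_of_pos (by norm_num : (0 : ℝ) < 2)]
    congr 1
    rw [hu]
    field_simp
  have h5 : (m * ((i : ℝ) + 1)) ^ (max β 1) = m ^ (max β 1) * ((i : ℝ) + 1) ^ (max β 1) :=
    Real.mul_rpow hm0.le (by linarith)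
  calc ((i : ℝ) + 1) ^ β ≤ ((i : ℝ) + 1) ^ (max β 1) := h1
    _ = (m ^ (max β 1))⁻¹ * (m ^ (max β 1) * ((i : ℝ) + 1) ^ (max β 1)) := by
        rw [← mul_assoc, inv_mul_cancel₀ hmβ.ne', one_mul]
    _ ≤ (m ^ (max β 1))⁻¹ * (2 : ℝ) ^ (δ * (i : ℝ)) := by
        apply mul_le_mul_of_nonneg_left _ (inv_pos.mpr hmβ).le
        rw [← h5, ← h4]
        exact h3

/-- The one-step recursion.  Chaining docking entropy, the injection and pinch rarity, the
renormalised block masses `Q i := R i * 2^(-s i)` satisfy `Q i ^ 2 ≤ B Q (i+1) + A` for `i ≥ i₀`. -/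
private lemma ledgerBootstrap_one_step {κ π s K₁ c C b : ℝ} {i₀ : ℕ} {R D U : ℕ → ℝ}
    (hκ : 0 ≤ κ) (hs1 : 1 - (κ + π) < s) (hs2 : -(3 : ℝ) / 2 ≤ s)
    (hK₁ : 0 < K₁) (hc : 0 < c) (hR : ∀ i, 0 ≤ R i)
    (hD : ∀ i : ℕ, D i ≤ K₁ * U i)
    (hDock : ∀ i : ℕ, i₀ ≤ i → c * (2 : ℝ) ^ ((κ - 1) * (i : ℝ)) * R i ^ 2 ≤ D i)
    (hU : ∀ i : ℕ, U i ≤ C * ((i : ℝ) + 1) ^ b * (2 : ℝ) ^ (-π * (i : ℝ)) * R (i + 1)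
      + C * (2 : ℝ) ^ (-(4 : ℝ) * (i : ℝ))) :
    ∃ B A : ℝ, 0 ≤ B ∧ 0 ≤ A ∧ ∀ i : ℕ, i₀ ≤ i →
      (R i * (2 : ℝ) ^ (-(s * (i : ℝ)))) ^ 2
        ≤ B * (R (i + 1) * (2 : ℝ) ^ (-(s * ((i + 1 : ℕ) : ℝ)))) + A := by
  have h2 : (0 : ℝ) < 2 := two_pos
  obtain ⟨M, hM0, hM⟩ := ledgerBootstrap_poly_le_geom b (s - (1 - (κ + π))) (by linarith)
  refine ⟨K₁ * |C| / c * M * (2 : ℝ) ^ s, K₁ * |C| / c, by positivity, by positivity,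
    fun i hi => ?_⟩
  have hi0 : (0 : ℝ) ≤ i := Nat.cast_nonneg i
  -- the two exponent bookkeeping facts
  have E1 : (2 : ℝ) ^ (-π * (i : ℝ)) * ((2 : ℝ) ^ (-(s * (i : ℝ)))) ^ 2
      * (2 : ℝ) ^ ((s - (1 - (κ + π))) * (i : ℝ))
      = (2 : ℝ) ^ ((κ - 1) * (i : ℝ)) * (2 : ℝ) ^ (-(s * ((i + 1 : ℕ) : ℝ))) * (2 : ℝ) ^ s := by
    simp only [sq, ← Real.rpow_add h2]
    congr 1
    push_cast
    ring
  have E2 : (2 : ℝ) ^ (-(4 : ℝ) * (i : ℝ)) * ((2 : ℝ) ^ (-(s * (i : ℝ)))) ^ 2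
      ≤ (2 : ℝ) ^ ((κ - 1) * (i : ℝ)) := by
    simp only [sq, ← Real.rpow_add h2]
    apply Real.rpow_le_rpow_of_exponent_le (by norm_num : (1 : ℝ) ≤ 2)
    have := mul_nonneg (show (0 : ℝ) ≤ κ + 3 + 2 * s by linarith) hi0
    nlinarith
  -- abbreviations for the powers of two (all positive)
  set a := (2 : ℝ) ^ ((κ - 1) * (i : ℝ)) with ha_def
  set e := (2 : ℝ) ^ (-π * (i : ℝ)) with he_def
  set f := (2 : ℝ) ^ (-(4 : ℝ) * (i : ℝ)) with hf_def
  set g := (2 : ℝ) ^ (-(s * (i : ℝ))) with hg_def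
  set g₁ := (2 : ℝ) ^ (-(s * ((i + 1 : ℕ) : ℝ))) with hg₁_def
  set w := (2 : ℝ) ^ ((s - (1 - (κ + π))) * (i : ℝ)) with hw_def
  set P := ((i : ℝ) + 1) ^ b with hP_def
  have ha : 0 < a := Real.rpow_pos_of_pos h2 _
  have hf : 0 < f := Real.rpow_pos_of_pos h2 _
  have he : 0 < e := Real.rpow_pos_of_pos h2 _
  have hg : 0 < g := Real.rpow_pos_of_pos h2 _
  have hg₁ : 0 < g₁ := Real.rpow_pos_of_pos h2 _
  have hw : 0 < w := Real.rpow_pos_of_pos h2 _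
  have h2s : 0 < (2 : ℝ) ^ s := Real.rpow_pos_of_pos h2 _
  have hP : 0 < P := Real.rpow_pos_of_pos (by positivity) _
  have hR' : 0 ≤ R (i + 1) := hR (i + 1)
  -- Step 1: chain the three structural inputs
  have h1 : c * a * R i ^ 2 ≤ K₁ * |C| * (P * e * R (i + 1) + f) := by
    have hX : 0 ≤ P * e * R (i + 1) := mul_nonneg (mul_nonneg hP.le he.le) hR'
    calc c * a * R i ^ 2 ≤ D i := hDock i hi
      _ ≤ K₁ * U i := hD i
      _ ≤ K₁ * (C * P * e * R (i + 1) + C * f) := mul_le_mul_of_nonneg_left (hU i) hK₁.le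
      _ ≤ K₁ * (|C| * (P * e * R (i + 1)) + |C| * f) := by
          apply mul_le_mul_of_nonneg_left _ hK₁.le
          have h₁ := mul_le_mul_of_nonneg_right (le_abs_self C) hX
          have h₂ := mul_le_mul_of_nonneg_right (le_abs_self C) hf.le
          linarith
      _ = K₁ * |C| * (P * e * R (i + 1) + f) := by ring
  -- Step 2: absorb the polynomial factor
  have hPeg : P * e * g ^ 2 ≤ M * (2 : ℝ) ^ s * g₁ * a := by
    have key : (P * e * g ^ 2) * w ≤ (M * (2 : ℝ) ^ s * g₁ * a) * w := by
      calc (P * e * g ^ 2) * w = P * (e * g ^ 2 * w) := by ring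
        _ = P * (a * g₁ * (2 : ℝ) ^ s) := by rw [E1]
        _ ≤ (M * w) * (a * g₁ * (2 : ℝ) ^ s) :=
            mul_le_mul_of_nonneg_right (hM i) (mul_nonneg (mul_nonneg ha.le hg₁.le) h2s.le)
        _ = (M * (2 : ℝ) ^ s * g₁ * a) * w := by ring
    exact le_of_mul_le_mul_right key hw
  -- Step 3: assemble
  have hca : 0 < c * a := mul_pos hc ha
  have hcne : c ≠ 0 := hc.ne'
  have key : c * a * ((R i * g) ^ 2)
      ≤ c * a * (K₁ * |C| / c * M * (2 : ℝ) ^ s * (R (i + 1) * g₁) + K₁ * |C| / c) := by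
    calc c * a * ((R i * g) ^ 2) = (c * a * R i ^ 2) * g ^ 2 := by ring
      _ ≤ K₁ * |C| * (P * e * R (i + 1) + f) * g ^ 2 :=
          mul_le_mul_of_nonneg_right h1 (sq_nonneg _)
      _ = K₁ * |C| * ((P * e * g ^ 2) * R (i + 1) + f * g ^ 2) := by ring
      _ ≤ K₁ * |C| * ((M * (2 : ℝ) ^ s * g₁ * a) * R (i + 1) + a) := by
          apply mul_le_mul_of_nonneg_left _ (by positivity)
          have := mul_le_mul_of_nonneg_right hPeg hR'
          linarith
      _ = c * a * (K₁ * |C| / c * M * (2 : ℝ) ^ s * (R (i + 1) * g₁) + K₁ * |C| / c) := by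
          field_simp
  exact le_of_mul_le_mul_left key hca

/-- The a-priori bound: from `t n ≤ exp (K √n)` the renormalised block mass
`R i * 2^(-s i)` is at most `exp ((6 + 2 |K|) 2^(i/2))` (for `s ≥ -3/2`). -/
private lemma ledgerBootstrap_apriori {t : ℕ → ℝ} {K s : ℝ}
    (hK : ∀ n : ℕ, t n ≤ Real.exp (K * Real.sqrt n)) (hs2 : -(3 : ℝ) / 2 ≤ s) (i : ℕ) :
    (∑ n ∈ Finset.Ico (2 ^ i) (2 ^ (i + 1)), t n) * (2 : ℝ) ^ (-(s * (i : ℝ)))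
      ≤ 1 * Real.exp ((6 + 2 * |K|) * (2 : ℝ) ^ ((i : ℝ) / 2)) := by
  have h2 : (0 : ℝ) < 2 := two_pos
  have hi0 : (0 : ℝ) ≤ i := Nat.cast_nonneg i
  set x := (2 : ℝ) ^ ((i : ℝ) / 2) with hx_def
  have hx0 : 0 ≤ x := (Real.rpow_pos_of_pos h2 _).le
  have hx2 : x ^ 2 = 2 ^ i := by
    rw [hx_def, sq, ← Real.rpow_add h2, add_halves, Real.rpow_natCast]
  have h2i : (0 : ℝ) ≤ 2 ^ i := by positivity
  -- termwise bound on the block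
  have hterm : ∀ n ∈ Finset.Ico (2 ^ i) (2 ^ (i + 1)), t n ≤ Real.exp (2 * |K| * x) := by
    intro n hn
    rw [Finset.mem_Ico] at hn
    have hn2 : (n : ℝ) < 2 ^ (i + 1) := by exact_mod_cast hn.2
    have hle : (n : ℝ) ≤ (2 * x) ^ 2 := by
      calc (n : ℝ) ≤ 2 ^ (i + 1) := hn2.le
        _ = 2 * 2 ^ i := by ring
        _ ≤ 4 * 2 ^ i := by linarith
        _ = (2 * x) ^ 2 := by rw [mul_pow, hx2]; norm_num
    have hsqrt : Real.sqrt n ≤ 2 * x := by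
      calc Real.sqrt n ≤ Real.sqrt ((2 * x) ^ 2) := Real.sqrt_le_sqrt hle
        _ = 2 * x := Real.sqrt_sq (by positivity)
    calc t n ≤ Real.exp (K * Real.sqrt n) := hK n
      _ ≤ Real.exp (2 * |K| * x) := by
          apply Real.exp_le_exp.mpr
          calc K * Real.sqrt n ≤ |K| * Real.sqrt n :=
                mul_le_mul_of_nonneg_right (le_abs_self K) (Real.sqrt_nonneg _)
            _ ≤ |K| * (2 * x) := mul_le_mul_of_nonneg_left hsqrt (abs_nonneg K)
            _ = 2 * |K| * x := by ring
  -- sum over the block: `2^i` terms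
  have hsum : (∑ n ∈ Finset.Ico (2 ^ i) (2 ^ (i + 1)), t n)
      ≤ 2 ^ i * Real.exp (2 * |K| * x) := by
    have h := Finset.sum_le_card_nsmul _ _ _ hterm
    rw [Nat.card_Ico, nsmul_eq_mul] at h
    have h' : 2 ^ (i + 1) - 2 ^ i = 2 ^ i := by
      have : 2 ^ (i + 1) = 2 * 2 ^ i := by ring
      omega
    have hcard : ((2 ^ (i + 1) - 2 ^ i : ℕ) : ℝ) = (2 : ℝ) ^ i := by
      rw [h', Nat.cast_pow, Nat.cast_ofNat]
    rwa [hcard] at h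
  -- the renormalising factor: `2^(-s i) ≤ 4^i` since `s ≥ -3/2 ≥ -2`
  have hg : (2 : ℝ) ^ (-(s * (i : ℝ))) ≤ 4 ^ i := by
    have hsi := mul_nonneg (show (0 : ℝ) ≤ s + 2 by linarith) hi0
    calc (2 : ℝ) ^ (-(s * (i : ℝ))) ≤ (2 : ℝ) ^ ((2 : ℝ) * (i : ℝ)) :=
          Real.rpow_le_rpow_of_exponent_le (by norm_num) (by nlinarith)
      _ = 4 ^ i := by
          rw [Real.rpow_mul h2.le, Real.rpow_two, Real.rpow_natCast]
          norm_num
  -- `8^i = x^6 ≤ exp (6 x)`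
  have h8 : (2 : ℝ) ^ i * 4 ^ i ≤ Real.exp (6 * x) := by
    have h81 : x ^ 6 = (2 : ℝ) ^ i * 4 ^ i := by
      calc x ^ 6 = (x ^ 2) ^ 3 := by rw [← pow_mul]
        _ = (2 ^ i) ^ 3 := by rw [hx2]
        _ = (2 ^ 3) ^ i := by rw [← pow_mul, ← pow_mul, mul_comm]
        _ = (2 * 4) ^ i := by norm_num
        _ = 2 ^ i * 4 ^ i := mul_pow 2 4 i
    have hxe : x ≤ Real.exp x := by linarith [Real.add_one_le_exp x]
    calc (2 : ℝ) ^ i * 4 ^ i = x ^ 6 := h81.symm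
      _ ≤ Real.exp x ^ 6 := pow_le_pow_left₀ hx0 hxe 6
      _ = Real.exp (6 * x) := by rw [← Real.exp_nat_mul]; norm_num
  -- combine
  calc (∑ n ∈ Finset.Ico (2 ^ i) (2 ^ (i + 1)), t n) * (2 : ℝ) ^ (-(s * (i : ℝ)))
      ≤ (2 ^ i * Real.exp (2 * |K| * x)) * 4 ^ i :=
        mul_le_mul hsum hg (by positivity) (by positivity)
    _ = (2 ^ i * 4 ^ i) * Real.exp (2 * |K| * x) := by ring
    _ ≤ Real.exp (6 * x) * Real.exp (2 * |K| * x) :=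
        mul_le_mul_of_nonneg_right h8 (Real.exp_pos _).le
    _ = 1 * Real.exp ((6 + 2 * |K|) * x) := by
        rw [← Real.exp_add, one_mul]
        congr 1
        ring

/-- The bootstrap: a nonnegative sequence with `Q i ^ 2 ≤ B Q (i+1) + A` for `i ≥ i₀` and the
a-priori bound `Q i ≤ L₀ exp (E 2^(i/2))` is bounded. -/
private lemma ledgerBootstrap_bootstrap (Q : ℕ → ℝ) {B A E L₀ : ℝ} {i₀ : ℕ}
    (hQ : ∀ i, 0 ≤ Q i) (hB : 0 ≤ B) (hA : 0 ≤ A) (hE : 0 ≤ E) (hL₀ : 0 ≤ L₀)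
    (hrec : ∀ i : ℕ, i₀ ≤ i → Q i ^ 2 ≤ B * Q (i + 1) + A)
    (hapr : ∀ i : ℕ, Q i ≤ L₀ * Real.exp (E * (2 : ℝ) ^ ((i : ℝ) / 2))) :
    ∃ M : ℝ, ∀ i : ℕ, Q i ≤ M := by
  have h2 : (0 : ℝ) < 2 := two_pos
  set M₀ := ∑ j ∈ Finset.range i₀, Q j with hM₀_def
  have hM₀ : 0 ≤ M₀ := Finset.sum_nonneg fun j _ => hQ j
  have hQM₀ : ∀ j, j < i₀ → Q j ≤ M₀ := fun j hj =>
    Finset.single_le_sum (fun k _ => hQ k) (Finset.mem_range.mpr hj)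
  set L := 1 + L₀ + M₀ + B + A with hL_def
  have hL1 : 1 ≤ L := by linarith
  have hL0 : 0 ≤ L := by linarith
  have hLL₀ : L₀ ≤ L := by linarith
  have hLM₀ : M₀ ≤ L := by linarith
  have hLsq : B * L + A ≤ L ^ 2 := by
    have h1 : B + A + 1 ≤ L := by linarith
    have h2' : L * (B + A + 1) ≤ L * L := mul_le_mul_of_nonneg_left h1 hL0
    have h3 : A ≤ L * A := le_mul_of_one_le_left hA hL1
    nlinarith
  -- the bootstrap invariant, by induction on `r`
  have key : ∀ r j : ℕ, Q j ≤ L * Real.exp (E * (2 : ℝ) ^ (((j : ℝ) - (r : ℝ)) / 2)) := by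
    intro r
    induction r with
    | zero =>
      intro j
      have := hapr j
      simp only [Nat.cast_zero, sub_zero]
      exact this.trans (mul_le_mul_of_nonneg_right hLL₀ (Real.exp_pos _).le)
    | succ r ih =>
      intro j
      set X := E * (2 : ℝ) ^ (((j : ℝ) - ((r + 1 : ℕ) : ℝ)) / 2) with hX_def
      have hX0 : 0 ≤ X := mul_nonneg hE (Real.rpow_pos_of_pos h2 _).le
      have hexp1 : 1 ≤ Real.exp X := Real.one_le_exp hX0
      rcases lt_or_ge j i₀ with hj | hj
      · calc Q j ≤ L := (hQM₀ j hj).trans hLM₀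
          _ ≤ L * Real.exp X := le_mul_of_one_le_right hL0 hexp1
      · have hid : E * (2 : ℝ) ^ ((((j + 1 : ℕ) : ℝ) - (r : ℝ)) / 2) = 2 * X := by
          have : (((j + 1 : ℕ) : ℝ) - (r : ℝ)) / 2
              = 1 + ((j : ℝ) - ((r + 1 : ℕ) : ℝ)) / 2 := by
            push_cast
            ring
          rw [hX_def, this, Real.rpow_add h2, Real.rpow_one]
          ring
        set e' := Real.exp (E * (2 : ℝ) ^ ((((j + 1 : ℕ) : ℝ) - (r : ℝ)) / 2)) with he'_def
        have he'0 : 0 ≤ e' := (Real.exp_pos _).le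
        have he'1 : 1 ≤ e' :=
          Real.one_le_exp (mul_nonneg hE (Real.rpow_pos_of_pos h2 _).le)
        have he' : e' = Real.exp X ^ 2 := by
          rw [he'_def, hid, sq, ← Real.exp_add]
          ring_nf
        have hih : Q (j + 1) ≤ L * e' := ih (j + 1)
        have h4 : Q j ^ 2 ≤ (L * Real.exp X) ^ 2 := by
          calc Q j ^ 2 ≤ B * Q (j + 1) + A := hrec j hj
            _ ≤ B * (L * e') + A := by
                have := mul_le_mul_of_nonneg_left hih hB
                linarith
            _ ≤ B * (L * e') + A * e' := by
                have := le_mul_of_one_le_right hA he'1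
                linarith
            _ = (B * L + A) * e' := by ring
            _ ≤ L ^ 2 * e' := mul_le_mul_of_nonneg_right hLsq he'0
            _ = (L * Real.exp X) ^ 2 := by rw [he']; ring
        calc Q j = Real.sqrt (Q j ^ 2) := (Real.sqrt_sq (hQ j)).symm
          _ ≤ Real.sqrt ((L * Real.exp X) ^ 2) := Real.sqrt_le_sqrt h4
          _ = L * Real.exp X := Real.sqrt_sq (by positivity)
  refine ⟨L * Real.exp E, fun i => ?_⟩
  have := key i i
  simpa using this

/-- **The ledger bootstrap** (stub S4 `stub_ledgerBootstrap` of line `docking-census-joining`,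
crux `stmt-CriticalPhenomena-7117`).  The exponent ledger `θ - 1 = κ + π` as a theorem about
nonnegative sequences: if `t n ≤ exp (K √n)` (a priori), `D i ≤ K₁ U i` (injection),
`c 2^((κ-1) i) R_i² ≤ D i` for `i ≥ i₀` (docking entropy) and
`U i ≤ C (i+1)^b 2^(-π i) R_{i+1} + C 2^(-4 i)` (pinch rarity), where
`R_i := ∑ n ∈ [2^i, 2^(i+1)), t n`, then for every `s > 1 - (κ + π)` with `s ≥ -3/2` there is
`C'` with `R_i ≤ C' 2^(s i)` for all `i`. -/
theorem stub_ledgerBootstrap :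
    ∀ (κ π : ℝ), 0 ≤ κ →
    ∀ (t D U : ℕ → ℝ), (∀ n : ℕ, 0 ≤ t n) →
      (∃ K : ℝ, ∀ n : ℕ, t n ≤ Real.exp (K * Real.sqrt n)) →
      (∃ K₁ : ℝ, 0 < K₁ ∧ ∀ i : ℕ, D i ≤ K₁ * U i) →
      (∃ c : ℝ, 0 < c ∧ ∃ i₀ : ℕ, ∀ i : ℕ, i₀ ≤ i →
          c * (2 : ℝ) ^ ((κ - 1) * (i : ℝ)) * (∑ n ∈ Finset.Ico (2 ^ i) (2 ^ (i + 1)), t n) ^ 2 ≤ D i) →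
      (∃ C b : ℝ, ∀ i : ℕ,
          U i ≤ C * ((i : ℝ) + 1) ^ b * (2 : ℝ) ^ (-π * (i : ℝ)) *
              (∑ n ∈ Finset.Ico (2 ^ (i + 1)) (2 ^ (i + 1 + 1)), t n)
            + C * (2 : ℝ) ^ (-(4 : ℝ) * (i : ℝ))) →
      ∀ s : ℝ, 1 - (κ + π) < s → -(3 : ℝ) / 2 ≤ s →
        ∃ C' : ℝ, ∀ i : ℕ, (∑ n ∈ Finset.Ico (2 ^ i) (2 ^ (i + 1)), t n) ≤ C' * (2 : ℝ) ^ (s * (i : ℝ)) := by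
  intro κ π hκ t D U ht hK hD hDock hU s hs1 hs2
  obtain ⟨K, hK⟩ := hK
  obtain ⟨K₁, hK₁, hD⟩ := hD
  obtain ⟨c, hc, i₀, hDock⟩ := hDock
  obtain ⟨C, b, hU⟩ := hU
  have hR0 : ∀ i : ℕ, 0 ≤ ∑ n ∈ Finset.Ico (2 ^ i) (2 ^ (i + 1)), t n :=
    fun i => Finset.sum_nonneg fun n _ => ht n
  obtain ⟨B, A, hB, hA, hrec⟩ := ledgerBootstrap_one_step (s := s)
    (R := fun i => ∑ n ∈ Finset.Ico (2 ^ i) (2 ^ (i + 1)), t n)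
    hκ hs1 hs2 hK₁ hc hR0 hD hDock hU
  have hE : (0 : ℝ) ≤ 6 + 2 * |K| := by positivity
  obtain ⟨M, hM⟩ := ledgerBootstrap_bootstrap
    (fun i => (∑ n ∈ Finset.Ico (2 ^ i) (2 ^ (i + 1)), t n) * (2 : ℝ) ^ (-(s * (i : ℝ))))
    (fun i => mul_nonneg (hR0 i) (Real.rpow_pos_of_pos two_pos _).le) hB hA hE zero_le_one
    hrec (fun i => ledgerBootstrap_apriori hK hs2 i)
  refine ⟨M, fun i => ?_⟩
  have hpos : 0 < (2 : ℝ) ^ (s * (i : ℝ)) := Real.rpow_pos_of_pos two_pos _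
  have hM' := mul_le_mul_of_nonneg_right (hM i) hpos.le
  have hone : (2 : ℝ) ^ (-(s * (i : ℝ))) * (2 : ℝ) ^ (s * (i : ℝ)) = 1 := by
    rw [← Real.rpow_add two_pos, neg_add_cancel, Real.rpow_zero]
  calc (∑ n ∈ Finset.Ico (2 ^ i) (2 ^ (i + 1)), t n)
      = (∑ n ∈ Finset.Ico (2 ^ i) (2 ^ (i + 1)), t n)
          * ((2 : ℝ) ^ (-(s * (i : ℝ))) * (2 : ℝ) ^ (s * (i : ℝ))) := by rw [hone, mul_one]
    _ = (∑ n ∈ Finset.Ico (2 ^ i) (2 ^ (i + 1)), t n) * (2 : ℝ) ^ (-(s * (i : ℝ)))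
          * (2 : ℝ) ^ (s * (i : ℝ)) := by ring
    _ ≤ M * (2 : ℝ) ^ (s * (i : ℝ)) := hM'

end Summit.CriticalPhenomena.SAWScalingLimit.Theorems.CriticalBubbleBound.Docking

end
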